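import Mathlib.Data.Rat.Defs
import Std.Data.HashMap
import HarnessLib

/-!
# The super Fock space of an abelian surface and its vertex operators (computable engine)

Area `Literature/Computation/AbelianHilbFock` (compute infrastructure, cell `hodge-kum4`, lane (V), seat
`hodge-kum4-veng`): a COMPUTABLE model of the Nakajima–Grojnowski Fock space
`F_A = ⊕ₙ H*(A^[n]; ℚ)` of an abelian surface `A`, `H*(A) = Λ*ℚ⁴` (an `(8|8)`-dimensional super vector
space), together with the operators that the lane's closure statements use:

* creation operators `q_m(x) = 𝔞_{-m}(x)` and annihilation operators `𝔞_m(x)` (`m > 0`) with the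
  Heisenberg SUPER-relations `[𝔞_m(x), 𝔞_l(y)] = -m δ_{m+l,0} (∫_A x y) · Id`
  (Li–Qin–Wang, super-commutator `[f,g] = fg - (-1)^{|f||g|} gf`);
* the Chern-character (cup-product) operators `𝔊_k(γ)` of Li–Qin–Wang in the CLOSED FORM valid for a
  surface with numerically trivial canonical class and Euler class `e = 0` (an abelian surface):
  `𝔊_k(γ) = - Σ_{ℓ(λ) = k+2, |λ| = 0} 𝔞_λ(τ_*γ) / λ^!` (only `k = 0, 1` are implemented: the lane's
  operator set consists of `𝔊₀(e_I)` (`|I| ≤ 3`), `𝔊₁(1)`, `𝔊₁(e_I)` (`|I| = 1`));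
* the degree operator `h`, `e_α = 𝔊₀(α)` and the Lefschetz dual `f_α` for `α = e₀∧e₁ + e₂∧e₃`, the
  latter as the second quantisation (a super-derivation of the Fock space killing the vacuum) of
  `Λ_α ⊗ m⁻¹`, where `Λ_α` is the unique degree `-2` operator on `Λ*ℚ⁴` with `[L_α, Λ_α] = h_A`
  (`lambdaTable`; checked in-kernel by `lambda_sl2`).  On `A^[n]` one has `[e_α, f_α] = h`,
  `[h, e_α] = 2 e_α`, `[h, f_α] = -2 f_α` (checked here on all of `H*(A^[3])` by `sl2Check3`).

Everything is plumbing for CERTIFICATES (`WindowCertificate10*.lean` in this directory): monomial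
bases of `H^{≤D}(A^[n])`, operator columns modulo the prime `p = 2³¹ - 1`, replay of word lists
(each word = one operator applied to an earlier word, starting from the monomial `q₁(1)ⁿ|0⟩`) and
graded ranks modulo `p` by dense Gaussian elimination per (degree, torus-weight) block.  No statement of
algebraic geometry is made in this file: the identification of these operators with cup products /
Lefschetz operators on Hilbert schemes is the cited literature (and the lane's typed interface), exactly
as for `KummerOrbifold/`.  Conventions (all fixed here): basis `e_I` of `Λ*ℚ⁴` indexed by bitmasks
`I ⊂ {0,1,2,3}`, `∫_A e₀e₁e₂e₃ = 1`; Künneth components and `τ_{k*}` by the projection formula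
`∫_{A^k} τ_{k*}(x)·(y₁⊗…⊗y_k) = ∫_A x y₁⋯y_k` with Koszul signs; `𝔞_λ = ∏ᵢ 𝔞ᵢ^{mᵢ}` in increasing
order of `i` (creators left); a letter is `16·m + I` (the creator `q_m(e_I)`), a monomial a sorted
list of letters (odd letters at most once), its cohomological degree `Σ (2m - 2 + |I|)`.
Validation of this engine against its Python twin and against geometry (Heisenberg relations, Betti
numbers, `sl₂`, the ring of `A^[2]`, LQW's generation theorem, the Kummer-side model through the
Kapfer–Menet cover) is recorded in the cell's report `pub/hodge-kum4/veng/REPORT-veng.md`; the in-file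
`example`s / theorems below re-check the cheapest of them in the kernel's evaluator.

Sources: Nakajima, Ann. of Math. 145 (1997) Thm 1.1, §8; Grojnowski, Math. Res. Lett. 3 (1996);
Li–Qin–Wang, Math. Ann. 324 (2002) §2 (eq. (2.7), Thm 2.16) and IMRN 2002 §3–§4 (Thm 3.1, Def 4.1,
Thm 4.6); Lehn, Invent. Math. 136 (1999) (the boundary operator); Oberdieck, Comment. Math. Helv. 96
(2021) §3.2 (Lemma 3.4: commutators of `-Σ n^{s} q_n q_{-n}(Γ)` with Nakajima operators).
-/

set_option autoImplicit false

namespace Literature.Computation.AbelianHilbFock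

/-! ## `H*(A) = Λ*ℚ⁴` on bitmasks -/

/-- Number of set bits among the low four (the cohomological degree of `e_I`). [folklore] -/
def deg4 (I : Nat) : Nat :=
  (I &&& 1) + ((I >>> 1) &&& 1) + ((I >>> 2) &&& 1) + ((I >>> 3) &&& 1)

/-- Sign of `e_I ∧ e_J = ± e_{I ∪ J}` (`0` if `I ∩ J ≠ ∅`): parity of the pairs `(i ∈ I, j ∈ J)` with
`i > j`. [folklore] -/
def wedgeSign (I J : Nat) : Int :=
  if I &&& J != 0 then 0 else
  let inv := (List.range 4).foldl (fun s i ↦ if (I >>> i) &&& 1 == 1 then s + deg4 (J &&& ((1 <<< i) - 1)) else s) 0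
  if inv % 2 == 0 then 1 else -1

/-- The pairing `∫_A e_I e_J` (`±1` if `J` is the complement of `I`, else `0`). [folklore] -/
def gpair (I J : Nat) : Int := if I ||| J == 15 then wedgeSign I J else 0

/-- The coefficient of `e_{J₁} ⊗ ⋯ ⊗ e_{J_k}` in `τ_{k*}(e_I)` (projection-formula convention of the
module docstring): `∫_A e_I e_{J₁ᶜ}⋯e_{J_kᶜ}` divided by `⟨⊗e_{J_a}, ⊗e_{J_aᶜ}⟩ = (-1)^{Σ_{a>b}|J_a||J_bᶜ|} ∏ g(J_a,J_aᶜ)`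
(a unit). [cite: LiQinWang2002W, §3 (the notation 𝔞_{m₁}⋯𝔞_{m_k}(τ_{k*}α), p. 6)] -/
def tauCoeff (I : Nat) (Js : List Nat) : Int :=
  let num : Int × Nat := Js.foldl (fun acc J ↦
    if acc.1 == 0 then acc else
      let s := wedgeSign acc.2 (15 - J)
      if s == 0 then ((0 : Int), 0) else (acc.1 * s, acc.2 ||| (15 - J))) (1, I)
  if num.1 == 0 || num.2 != 15 then 0 else
  let kz : Nat := Id.run do
    let mut t := 0
    let arr := Js.toArray
    for a in [0:arr.size] do
      for b in [0:a] do
        t := t + deg4 arr[a]! * deg4 (15 - arr[b]!)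
    return t
  let den : Int := Js.foldl (fun d J ↦ d * gpair J (15 - J)) (if kz % 2 == 0 then 1 else -1)
  num.1 * den

/-- All index tuples `(J₁,…,J_k)` with non-zero coefficient in `τ_{k*}(e_I)`, with that coefficient. [cite: LiQinWang2002W, §3 (the notation 𝔞_{m₁}⋯𝔞_{m_k}(τ_{k*}α), p. 6)] -/
def tauEntries (k I : Nat) : List (List Nat × Int) :=
  let tuples : List (List Nat) := (List.range k).foldl (fun acc _ ↦ acc.flatMap fun t ↦ (List.range 16).map fun J ↦ t ++ [J]) [[]]
  tuples.filterMap fun Js ↦ let c := tauCoeff I Js; if c == 0 then none else some (Js, c)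

/-- The class `α = e₀∧e₁ + e₂∧e₃` (bitmasks `3` and `12`), `(α, α) = 2`. [folklore] -/
def alphaMasks : List Nat := [3, 12]

/-- The dual Lefschetz operator `Λ_α` of `L_α = α ∧ (-)` on `Λ*ℚ⁴`, as the list of its non-zero matrix
entries `(Q, P, c)`: `Λ_α e_P = Σ c · e_Q`.  (All entries are `1`: `Λ(e₀₁) = Λ(e₂₃) = 1`,
`Λ(pt) = α`, and on `H³` the contractions `e₀e₁e_j ↦ e_j`, `e_ie₂e₃ ↦ e_i`.)  That this IS the dual
Lefschetz operator (`[L_α, Λ_α] = h_A = deg - 2`) is `lambda_sl2` below. [folklore] -/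
def lambdaTable : List (Nat × Nat × Int) :=
  [(0, 3, 1), (0, 12, 1), (4, 7, 1), (8, 11, 1), (1, 13, 1), (2, 14, 1), (3, 15, 1), (12, 15, 1)]

/-- Matrix of `L_α` on the basis `e_P`: entries `(Q, P, c)`. [folklore] -/
def lefschetzTable : List (Nat × Nat × Int) :=
  (List.range 16).flatMap fun P ↦ alphaMasks.filterMap fun a ↦
    let s := wedgeSign a P
    if s == 0 then none else some (a ||| P, P, s)

/-- Entry `(Q,P)` of the commutator `[L_α, Λ_α]` computed from the two tables. [folklore] -/
def commLLamEntry (Q P : Nat) : Int :=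
  let lam (a b : Nat) : Int := (lambdaTable.filter fun t ↦ t.1 == a && t.2.1 == b).foldl (fun s t ↦ s + t.2.2) 0
  let el (a b : Nat) : Int := (lefschetzTable.filter fun t ↦ t.1 == a && t.2.1 == b).foldl (fun s t ↦ s + t.2.2) 0
  (List.range 16).foldl (fun s R ↦ s + el Q R * lam R P - lam Q R * el R P) 0

/-- **`Λ_α` is the dual Lefschetz operator on `Λ*ℚ⁴`:** `[L_α, Λ_α] = h_A` with `h_A e_P = (|P| - 2) e_P`
(all `256` matrix entries). [cite: LooijengaLunts1997, §1 p. 4 (the dual Lefschetz operator f_a of an sl₂-triple)] -/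
theorem lambda_sl2 : ((List.range 16).all fun Q ↦ (List.range 16).all fun P ↦
    commLLamEntry Q P == (if Q == P then (deg4 P : Int) - 2 else 0)) = true := by
  decide +kernel

/-! ## Letters and monomials -/

/-- A monomial of creation operators `q_{m₁}(e_{I₁}) ⋯ q_{m_k}(e_{I_k}) |0⟩` as the SORTED list of its
letters `16·m + I` (odd letters pairwise distinct). [cite: Nakajima1997, Thm 1.1 and §8 (the Fock space basis)] -/
abbrev Mono := List Nat

/-- Parity of a letter (`|I| mod 2`). [folklore] -/
@[inline] def lPar (l : Nat) : Nat := deg4 (l % 16) % 2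
/-- Cohomological degree `2m - 2 + |I|` of a letter. [folklore] -/
@[inline] def lDeg (l : Nat) : Nat := 2 * (l / 16) - 2 + deg4 (l % 16)
/-- Cohomological degree of a monomial. [folklore] -/
def mDeg (mono : Mono) : Nat := mono.foldl (fun s l ↦ s + lDeg l) 0
/-- Number of points `Σ m` of a monomial. [folklore] -/
def mPts (mono : Mono) : Nat := mono.foldl (fun s l ↦ s + l / 16) 0
/-- Weight for the 2-torus of `Sp(4)` fixing `α` (`e₀ ↦ (1,0)`, `e₁ ↦ (-1,0)`, `e₂ ↦ (0,1)`, `e₃ ↦ (0,-1)`),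
shifted by `+32` in each coordinate to stay in `ℕ`, packed as `64·w₀ + w₁`. [folklore] -/
def mWeight (mono : Mono) : Nat :=
  let w0 : Int := mono.foldl (fun s l ↦ s + (if l &&& 1 == 1 then 1 else 0) - (if (l >>> 1) &&& 1 == 1 then 1 else 0)) 0
  let w1 : Int := mono.foldl (fun s l ↦ s + (if (l >>> 2) &&& 1 == 1 then 1 else 0) - (if (l >>> 3) &&& 1 == 1 then 1 else 0)) 0
  (w0 + 32).toNat * 64 + (w1 + 32).toNat

/-- Insert the letter `lt` into the sorted monomial as if it stood IN FRONT of it: returns the Koszul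
sign and the sorted result, or `none` if `lt` is odd and already present. [cite: LiQinWang2002, §2 eq. (2.7) (the super-commutator convention)] -/
def insertLetter (lt : Nat) : Mono → Option (Int × Mono)
  | [] => some (1, [lt])
  | x :: xs =>
    if lt < x then some (1, lt :: x :: xs)
    else if lt == x then (if lPar lt == 1 then none else some (1, lt :: x :: xs))
    else match insertLetter lt xs with
      | none => none
      | some (s, ys) => some ((if lPar lt == 1 && lPar x == 1 then -s else s), x :: ys)

/-- The annihilator `𝔞_m(e_K)` (`m > 0`) on a monomial: a super-derivation with
`[𝔞_m(e_K), q_l(e_P)] = -m δ_{m,l} ∫ e_K e_P`; returns the list of (integer coefficient, monomial). [cite: LiQinWang2002W, Thm 3.1(i) (Heisenberg relations, sign convention)] -/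
def annihilate (m K : Nat) (mono : Mono) : List (Int × Mono) :=
  let P := 15 - K
  let g := gpair K P
  let t := 16 * m + P
  let odd := lPar t == 1
  let rec go : Mono → List Nat → Nat → List (Int × Mono)
    | [], _, _ => []
    | x :: xs, pre, nodd =>
      if x == t then
        let sign : Int := if odd && nodd % 2 == 1 then -1 else 1
        let here := (sign * (-(m : Int)) * g, pre.reverseAux xs)
        if odd then [here] else here :: go xs (x :: pre) (nodd + lPar x)
      else go xs (x :: pre) (nodd + lPar x)
  if g == 0 then [] else go mono [] 0

/-- One elementary operator `𝔞_i(e_J)` (`i < 0`: the creator `q_{-i}(e_J)`; `i > 0`: annihilator) applied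
to a linear combination (list of (coefficient, monomial), duplicates allowed). [cite: LiQinWang2002W, Thm 3.1(i) (Heisenberg relations, sign convention)] -/
def applyElem (i : Int) (J : Nat) (v : List (Int × Mono)) : List (Int × Mono) :=
  if i < 0 then
    let lt := 16 * (-i).toNat + J
    v.filterMap fun (c, mono) ↦ match insertLetter lt mono with
      | none => none
      | some (s, nm) => some (s * c, nm)
  else
    v.flatMap fun (c, mono) ↦ (annihilate i.toNat J mono).map fun (d, nm) ↦ (c * d, nm)

/-! ## Operators -/

/-- A term of a normally ordered operator after Künneth expansion: the chain of elementary operators in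
ACTING order (rightmost factor first) and an integer coefficient; `den` is a common denominator kept
separately (`1/λ^!`). [cite: LiQinWang2002W, Def 4.1 and Thm 4.6] -/
structure Chain where
  ops : List (Int × Nat)
  coeff : Int
  deriving Inhabited

/-- An operator of the lane: either a sum of normally ordered Künneth-expanded monomials in the `𝔞`'s
(indexed by the letters its annihilators remove, in acting order: `byAnn1` for one annihilator, key the
letter; `byAnn2` for two, key `256·L₁ + L₂`), with a global denominator, or the super-derivation
second-quantising a one-particle operator `M ⊗ m^s` (`s ∈ {1, 0, -1}`) of parity `par`.
`cdeg` = change of cohomological degree (as an integer). [cite: LiQinWang2002W, Thm 4.6 (𝔊_k for K, e numerically trivial)] -/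
structure Op where
  name : String
  byAnn1 : Std.HashMap Nat (Array Chain)
  byAnn2 : Std.HashMap Nat (Array Chain)
  den : Nat
  derivTable : Array (List (Nat × Int))
  derivPow : Int
  par : Nat
  isDeriv : Bool
  cdeg : Int
  deriving Inhabited

/-- Generalized partitions `λ` with `ℓ(λ) = len ∈ {2,3}`, `|λ| = 0`, parts in `[-n, n] ∖ {0}`, as
increasing lists, with `λ^!`. [cite: LiQinWang2002W, Def 4.1 (generalized partitions, λ^!)] -/
def genPartitionsZero (len n : Nat) : List (List Int × Nat) :=
  if len == 2 then (List.range n).map fun (a : Nat) ↦ (([-((a : Int) + 1), (a : Int) + 1] : List Int), (1 : Nat))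
  else if len == 3 then
    ((List.range n).flatMap fun a0 ↦ (List.range n).filterMap fun b0 ↦
      let a := a0 + 1; let b := b0 + 1
      if a ≤ b && a + b ≤ n then some ([-((a + b : Nat) : Int), (a : Int), (b : Int)], if a == b then 2 else 1) else none)
    ++
    ((List.range n).flatMap fun a0 ↦ (List.range n).filterMap fun b0 ↦
      let a := a0 + 1; let b := b0 + 1
      if b ≤ a && a + b ≤ n then some ([-(a : Int), -(b : Int), ((a + b : Nat) : Int)], if a == b then 2 else 1) else none)
  else []

/-- `𝔊_k(e_I)` (`k ∈ {0,1}`) on `⊕_{n' ≤ n} H*(A^[n'])` in Li–Qin–Wang's normally ordered form: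
`- Σ_{ℓ(λ)=k+2, |λ|=0} 𝔞_λ(τ_* e_I)/λ^!`, stored with the common denominator `2` (coefficients `-2/λ^!`). [cite: LiQinWang2002W, Thm 4.6 (𝔊_k for K, e numerically trivial)] -/
def mkG (k I n : Nat) (name : String) : Op := Id.run do
  let entries := tauEntries (k + 2) I
  let mut byAnn1 : Std.HashMap Nat (Array Chain) := Std.HashMap.emptyWithCapacity 256
  let mut byAnn2 : Std.HashMap Nat (Array Chain) := Std.HashMap.emptyWithCapacity 1024
  for (lam, lfact) in genPartitionsZero (k + 2) n do
    let coeff : Int := -(2 / (lfact : Int))          -- -1/λ^! times the common denominator 2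
    for (Js, c) in entries do
      -- slots s = 0..len-1 pair lam[s] with Js[s]; acting order = reversed
      let pairs := (lam.zip Js).reverse
      let annLetters := pairs.filterMap fun (i, J) ↦ if i > 0 then some (16 * i.toNat + (15 - J)) else none
      let ch : Chain := { ops := pairs, coeff := coeff * c }
      match annLetters with
      | [L] => byAnn1 := byAnn1.insert L ((byAnn1.getD L #[]).push ch)
      | [L1, L2] => byAnn2 := byAnn2.insert (256 * L1 + L2) ((byAnn2.getD (256 * L1 + L2) #[]).push ch)
      | _ => pure ()
  return { name := name, byAnn1 := byAnn1, byAnn2 := byAnn2, den := 2, derivTable := #[], derivPow := 0, par := deg4 I % 2,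
           isDeriv := false, cdeg := (2 * k + deg4 I : Nat) }

/-- The super-derivation of parity `par` second-quantising the one-particle operator `e_P ↦ m^s Σ c e_Q`
(table of `(Q,P,c)`), killing the vacuum (`h`, `e_α`, `f_α`, and `𝔊₀(x)`: `q_m(y) ↦ m q_m(x y)`). [cite: Oberdieck2021, §3.2 Lemma 3.4 (commutator of T_Γ with Nakajima operators)] -/
def mkDeriv (name : String) (table : List (Nat × Nat × Int)) (s : Int) (par : Nat) (cdeg : Int) : Op :=
  let tab : Array (List (Nat × Int)) := (Array.range 16).map fun P ↦
    table.filterMap fun t ↦ if t.2.1 == P then some (t.1, t.2.2) else none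
  { name := name, byAnn1 := Std.HashMap.emptyWithCapacity 1, byAnn2 := Std.HashMap.emptyWithCapacity 1, den := 1,
    derivTable := tab, derivPow := s, par := par, isDeriv := true, cdeg := cdeg }

/-- `𝔊₀(e_I)` as the super-derivation `q_m(e_P) ↦ m · q_m(e_I ∧ e_P)` (Li–Qin–Wang: `[𝔊₀(x), 𝔞_{-m}(y)] = m 𝔞_{-m}(xy)`
for `e = 0`); equal to the two-point form `mkG 0 I n` as an operator — `G0_deriv_eq_twoPoint3` below. [cite: LiQinWang2002W, Thm 3.1(ii) (with 𝔏₀ = 𝔊₀ for e = 0)] -/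
def mkG0 (I : Nat) (name : String) : Op :=
  mkDeriv name ((List.range 16).filterMap fun P ↦ let s := wedgeSign I P; if s == 0 then none else some (I ||| P, P, s))
    1 (deg4 I % 2) (deg4 I : Int)

/-- Run the chains stored under a key on a monomial, appending `coeff/den · result`. [folklore] -/
@[inline] def runChains (den : Nat) (chs : Array Chain) (mono : Mono) (out : List (ℚ × Mono)) : List (ℚ × Mono) :=
  chs.foldl (fun o ch ↦
    let res := ch.ops.foldl (fun v p ↦ applyElem p.1 p.2 v) [(ch.coeff, mono)]
    res.foldl (fun o2 r ↦ (((r.1 : ℚ) / (den : ℚ)), r.2) :: o2) o) out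

/-- Apply an operator to a monomial: list of (rational coefficient, monomial), duplicates allowed. [cite: LiQinWang2002W, Thm 4.6 (𝔊_k for K, e numerically trivial)] -/
def Op.apply (op : Op) (mono : Mono) : List (ℚ × Mono) :=
  if op.isDeriv then Id.run do
    let arr := mono.toArray
    let mut out : List (ℚ × Mono) := []
    let mut noddBefore := 0
    for i in [0:arr.size] do
      let l := arr[i]!
      let m := l / 16
      let P := l % 16
      let tab := op.derivTable.getD P []
      if !tab.isEmpty then
        let rest : Mono := (arr.extract 0 i).toList ++ (arr.extract (i + 1) arr.size).toList
        let s0 : Int := if op.par == 1 && noddBefore % 2 == 1 then -1 else 1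
        for (Q, c) in tab do
          match insertLetter (16 * m + Q) rest with
          | none => pure ()
          | some (s2, nm) =>
            let s1 : Int := if lPar Q == 1 && noddBefore % 2 == 1 then -1 else 1
            let fac : ℚ := if op.derivPow == 1 then (m : ℚ) else if op.derivPow == -1 then (1 : ℚ) / (m : ℚ) else 1
            out := ((((s0 * s1 * s2 * c : Int)) : ℚ) * fac, nm) :: out
      noddBefore := noddBefore + lPar l
    return out
  else Id.run do
    let ds := mono.eraseDups
    let mut out : List (ℚ × Mono) := []
    for L1 in ds do
      match op.byAnn1.get? L1 with
      | some chs => out := runChains op.den chs mono out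
      | none => pure ()
      for L2 in ds do
        match op.byAnn2.get? (256 * L1 + L2) with
        | some chs => out := runChains op.den chs mono out
        | none => pure ()
    return out

/-- The lane's operator set `O` at `n` points, in the fixed order used by the word files:
`𝔊₀(e_I)` for `|I| ∈ {1,2,3}` (increasing `I`; derivation form), `𝔊₁(1)`, `𝔊₁(e_I)` for `|I| = 1`
(Li–Qin–Wang three-point form), `f_α`. [cite: LiQinWang2002W, Thm 4.6 (𝔊_k for K, e numerically trivial)] -/
def laneOps (n : Nat) : Array Op := Id.run do
  let mut ops : Array Op := #[]
  for I in [0:16] do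
    if deg4 I ≥ 1 && deg4 I ≤ 3 then ops := ops.push (mkG0 I s!"G0(e{I})")
  ops := ops.push (mkG 1 0 n "G1(1)")
  for I in [0:16] do
    if deg4 I == 1 then ops := ops.push (mkG 1 I n s!"G1(e{I})")
  ops := ops.push (mkDeriv "f_alpha" lambdaTable (-1) 0 (-2))
  return ops

/-- `e_α` as a derivation (`q_m(x) ↦ m q_m(α x)`), `h` (`q_m(x) ↦ (|x| - 2) q_m(x)`), `f_α`. [cite: Oberdieck2021, §3.2 (e_α, h, and the Lefschetz dual via T_Γ)] -/
def eOp : Op := mkDeriv "e_alpha" lefschetzTable 1 0 2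
/-- See `eOp`. [cite: Oberdieck2021, §3.2 (e_α, h, and the Lefschetz dual via T_Γ)] -/
def hOp : Op := mkDeriv "h" ((List.range 16).map fun P ↦ (P, P, (deg4 P : Int) - 2)) 0 0 0
/-- See `eOp`. [cite: Oberdieck2021, §3.2 (e_α, h, and the Lefschetz dual via T_Γ)] -/
def fOp : Op := mkDeriv "f_alpha" lambdaTable (-1) 0 (-2)

/-! ## Sparse vectors keyed by monomials (exact, for the small in-kernel checks) -/

/-- Exact sparse vector on monomials. [folklore] -/
abbrev MVec := Std.HashMap Mono ℚ

/-- Add `c · (terms)` into an `MVec`. [folklore] -/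
def MVec.addTerms (v : MVec) (terms : List (ℚ × Mono)) (c : ℚ := 1) : MVec :=
  terms.foldl (fun (w : MVec) (d, m) ↦
    let x := w.getD m 0 + c * d
    if x == 0 then w.erase m else w.insert m x) v

/-- Apply an operator to an exact sparse vector. [folklore] -/
def Op.applyVec (op : Op) (v : MVec) : MVec :=
  v.fold (fun (w : MVec) m c ↦ w.addTerms (op.apply m) c) (Std.HashMap.emptyWithCapacity 64)

/-- Equality test of exact sparse vectors. [folklore] -/
def MVec.beq (a b : MVec) : Bool :=
  a.size == b.size && a.fold (fun ok m c ↦ ok && b.getD m 0 == c) true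

/-! ## Monomial bases -/

/-- All letters `16 m + I` with `1 ≤ m ≤ n` and letter degree `≤ dmax`, increasing. [folklore] -/
def letters (n dmax : Nat) : List Nat :=
  ((List.range n).flatMap fun m0 ↦ (List.range 16).map fun I ↦ 16 * (m0 + 1) + I).filter fun l ↦ lDeg l ≤ dmax

/-- The monomial basis of `H^{≤ dmax}(A^[n])` (sorted letter lists with `Σ m = n`, degree `≤ dmax`,
odd letters distinct), in a fixed enumeration order. [cite: Nakajima1997, Thm 1.1 and §8 (the Fock space basis)] -/
def basis (n dmax : Nat) : Array Mono :=
  let ls := (letters n dmax).toArray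
  let rec go (fuel : Nat) (start remN remD : Nat) (cur : List Nat) (acc : Array Mono) : Array Mono :=
    match fuel with
    | 0 => acc
    | fuel + 1 =>
      if remN == 0 then acc.push cur.reverse else Id.run do
        let mut a := acc
        for j in [start:ls.size] do
          let l := ls[j]!
          let m := l / 16
          let d := lDeg l
          if m ≤ remN && d ≤ remD then
            a := go fuel (if lPar l == 1 then j + 1 else j) (remN - m) (remD - d) (l :: cur) a
        return a
  go (n + 1) 0 n dmax [] #[]

/-- Graded count of a monomial array (Betti numbers of the window). [cite: Gottsche1993, Thm 2.3.10 (Betti numbers of Hilbert schemes of points of a surface)] -/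
def gradedCount (B : Array Mono) (top : Nat) : List Nat :=
  (List.range (top + 1)).map fun d ↦ B.foldl (fun s m ↦ if mDeg m == d then s + 1 else s) 0

/-! ## Arithmetic modulo `p = 2³¹ - 1`, packed sparse columns, replay and ranks -/

/-- The prime `2³¹ - 1`. [folklore] -/
def PRIME : Nat := 2147483647

/-- `b^e mod p`. [folklore] -/
def powMod (b e : Nat) : Nat := Id.run do
  let mut r := 1
  let mut b := b % PRIME
  let mut e := e
  while e > 0 do
    if e % 2 == 1 then r := r * b % PRIME
    b := b * b % PRIME
    e := e / 2
  return r

/-- Inverse mod `p` (Fermat). [folklore] -/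
def invMod (a : Nat) : Nat := powMod a (PRIME - 2)

/-- A rational reduced mod `p` (numerator · denominator⁻¹); meaningful when `p ∤ den`. [folklore] -/
def ratModP (c : ℚ) : Nat :=
  let nm : Nat := if c.num ≥ 0 then c.num.toNat % PRIME else (PRIME - ((-c.num).toNat % PRIME)) % PRIME
  nm * invMod (c.den % PRIME) % PRIME

/-- The replay context at `n` points with degree window `dmax`: the monomial basis, its index, the
(degree, weight) block of every index, and the lane operators (columns are computed on demand,
`Ctx.colP`; images outside the window are dropped). [cite: GolubVanLoan2013, §1.1.8 (column-oriented gaxpy: Ax as a linear combination of columns)] -/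
structure Ctx where
  n : Nat
  dmax : Nat
  B : Array Mono
  index : Std.HashMap Mono Nat
  degOf : Array Nat
  blockOf : Array Nat
  blockSize : Std.HashMap Nat Nat
  locOf : Array Nat
  ops : Array Op

/-- Build the context. [folklore] -/
def Ctx.build (n dmax : Nat) : Ctx := Id.run do
  let B := basis n dmax
  let mut index : Std.HashMap Mono Nat := Std.HashMap.emptyWithCapacity (2 * B.size + 1)
  for i in [0:B.size] do index := index.insert B[i]! i
  let degOf := B.map mDeg
  let blockOf := (Array.range B.size).map fun i ↦ degOf[i]! * 4096 + mWeight B[i]!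
  let mut blockSize : Std.HashMap Nat Nat := Std.HashMap.emptyWithCapacity 1024
  let mut locOf : Array Nat := Array.replicate B.size 0
  for i in [0:B.size] do
    let b := blockOf[i]!
    let c := blockSize.getD b 0
    locOf := locOf.set! i c
    blockSize := blockSize.insert b (c + 1)
  return { n := n, dmax := dmax, B := B, index := index, degOf := degOf, blockOf := blockOf, blockSize := blockSize,
           locOf := locOf, ops := laneOps n }

/-- The column of operator `j` at basis index `i` modulo `p`, packed `target * 2^32 + value`, and a flag
telling whether some coefficient had a denominator divisible by `p` (never, for `n < p`). [cite: GolubVanLoan2013, §1.1.8 (column-oriented gaxpy: Ax as a linear combination of columns)] -/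
def Ctx.colP (C : Ctx) (j i : Nat) : Array Nat × Bool := Id.run do
  let terms := (C.ops.getD j hOp).apply (C.B.getD i [])
  let mut acc : Std.HashMap Nat Nat := Std.HashMap.emptyWithCapacity 32
  let mut ok := true
  for (c, m) in terms do
    if c.den % PRIME == 0 then ok := false
    match C.index.get? m with
    | none => pure ()      -- outside the window
    | some t =>
      let x := (acc.getD t 0 + ratModP c) % PRIME
      acc := if x == 0 then acc.erase t else acc.insert t x
  return (acc.fold (fun (a : Array Nat) t x ↦ a.push (t * 4294967296 + x)) #[], ok)

/-- A mod-`p` sparse vector on basis indices. [folklore] -/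
abbrev VecP := Std.HashMap Nat Nat

/-- Replay a word list: entry `(j, par)` = operator `j` applied to word number `par` (an earlier entry;
word `0` is the seed monomial `q₁(1)ⁿ|0⟩`, whose entry is ignored).  Columns are memoised.  Returns all
word vectors mod `p` and the conjunction of the denominator flags. [cite: GolubVanLoan2013, §1.1.8 (column-oriented gaxpy: Ax as a linear combination of columns)] -/
def Ctx.replay (C : Ctx) (words : Array (Nat × Nat)) : Array VecP × Bool := Id.run do
  let seedMono : Mono := List.replicate C.n 16
  let seed : VecP := (Std.HashMap.emptyWithCapacity 2).insert (C.index.getD seedMono 0) 1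
  let mut W : Array VecP := #[seed]
  let mut cache : Std.HashMap Nat (Array Nat) := Std.HashMap.emptyWithCapacity 65536
  let mut ok := true
  for k in [1:words.size] do
    let (j, par) := words[k]!
    let w := (W.getD par seed).toArray
    let mut acc : VecP := Std.HashMap.emptyWithCapacity 64
    for (i, c) in w do
      let key := j * 4294967296 + i
      let col ← match cache.get? key with
        | some col => pure col
        | none => do
          let (col, okc) := C.colP j i
          cache := cache.insert key col
          if !okc then ok := false
          pure col
      for packed in col do
        let t := packed / 4294967296
        let x := (acc.getD t 0 + c * (packed % 4294967296)) % PRIME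
        acc := if x == 0 then acc.erase t else acc.insert t x
    W := W.push acc
  return (W, ok)

/-- Dense Gaussian elimination mod `p` inside one block: rows as arrays; returns the rank of the given
rows. [folklore] -/
def rankModP (rows : Array (Array Nat)) (m : Nat) : Nat := Id.run do
  let mut piv : Array (Nat × Array Nat) := #[]      -- (pivot column, normalised row)
  for r0 in rows do
    let mut r := r0
    for (pc, prow) in piv do
      let c := r[pc]!
      if c != 0 then
        r := (Array.range m).map fun t ↦ (r[t]! + PRIME * PRIME - c * prow[t]!) % PRIME
    match (Array.range m).find? (fun t ↦ r[t]! != 0) with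
    | none => pure ()
    | some pc =>
      let iv := invMod r[pc]!
      let nr := r.map fun x ↦ x * iv % PRIME
      piv := piv.push (pc, nr)
  return piv.size

/-- Graded rank profile mod `p` (degrees `0..top`) of a family of word vectors: the vectors are split by
(degree, weight) block (every word vector is block-homogeneous; a vector meeting several blocks is
counted in none and flagged by making the profile empty), ranks are summed per degree. [folklore] -/
def Ctx.rankProfile (C : Ctx) (W : Array VecP) (top : Nat) : List Nat := Id.run do
  -- group vectors by block
  let mut byBlock : Std.HashMap Nat (Array (Array Nat)) := Std.HashMap.emptyWithCapacity 1024
  let mut bad := false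
  for w in W do
    if !w.isEmpty then
      let someIdx := w.fold (fun (_ : Nat) i _ ↦ i) 0
      let b := C.blockOf.getD someIdx 0
      let homog := w.fold (fun ok i _ ↦ ok && C.blockOf.getD i 0 == b) true
      if !homog then bad := true
      let m := C.blockSize.getD b 0
      let row := w.fold (fun (r : Array Nat) i x ↦ r.set! (C.locOf.getD i 0) x) (Array.replicate m 0)
      byBlock := byBlock.insert b ((byBlock.getD b #[]).push row)
  if bad then return []
  let mut prof : Array Nat := Array.replicate (top + 1) 0
  for (b, rows) in byBlock.toList do
    let d := b / 4096
    if d ≤ top then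
      prof := prof.set! d (prof[d]! + rankModP rows (C.blockSize.getD b 0))
  return prof.toList

/-- Decode a word list packed in a string of decimal numbers `j₁ p₁ j₂ p₂ …` separated by spaces
(entry `0` is the seed and carries the dummy pair `99 0`). [folklore] -/
def decodeWords (s : String) : Array (Nat × Nat) := Id.run do
  let nums := ((s.splitOn " ").filter fun t ↦ t != "").toArray.map String.toNat!
  let mut out : Array (Nat × Nat) := #[]
  for k in [0:nums.size / 2] do
    out := out.push (nums[2 * k]!, nums[2 * k + 1]!)
  return out

/-! ## In-kernel sanity checks of the engine (the cheapest gates of the report, re-run by the evaluator) -/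

/-- All basis monomials of `H*(A^[n])` (no window: `dmax = 4n`). [cite: Nakajima1997, Thm 1.1 and §8 (the Fock space basis)] -/
def fullBasis (n : Nat) : Array Mono := basis n (4 * n)

/-- `sl₂` check on all of `H*(A^[n])`: `[e_α,f_α] v = h v = (deg v - 2n) v`, `[h,e] v = 2 e v`,
`[h,f] v = -2 f v` for every basis monomial `v`, and `e_α` (derivation form) `= 𝔊₀(e₀₁) + 𝔊₀(e₂₃)`
(two-point form). [cite: Oberdieck2021, §3.2 (e_α, h, and the Lefschetz dual via T_Γ)] -/
def sl2Check (n : Nat) : Bool :=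
  let G3 := mkG 0 3 n "G0(e3)"
  let G12 := mkG 0 12 n "G0(e12)"
  (fullBasis n).all fun mono ↦
    let v : MVec := (Std.HashMap.emptyWithCapacity 2).insert mono 1
    let ev := eOp.applyVec v
    let fv := fOp.applyVec v
    let hv := hOp.applyVec v
    let ef := eOp.applyVec fv
    let fe := fOp.applyVec ev
    let lhs1 := fe.fold (fun (w : MVec) m c ↦ w.addTerms [(c, m)] (-1)) ef
    let hv' : MVec := MVec.addTerms (Std.HashMap.emptyWithCapacity 2) [(((mDeg mono : ℚ) - 2 * (n : ℚ)), mono)]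
    let he := hOp.applyVec ev
    let eh := eOp.applyVec hv
    let lhs2 := eh.fold (fun (w : MVec) m c ↦ w.addTerms [(c, m)] (-1)) he
    let rhs2 := ev.fold (fun (w : MVec) m c ↦ w.addTerms [(c, m)] 2) (Std.HashMap.emptyWithCapacity 8)
    let hf := hOp.applyVec fv
    let fh := fOp.applyVec hv
    let lhs3 := fh.fold (fun (w : MVec) m c ↦ w.addTerms [(c, m)] (-1)) hf
    let rhs3 := fv.fold (fun (w : MVec) m c ↦ w.addTerms [(c, m)] (-2)) (Std.HashMap.emptyWithCapacity 8)
    let e2 := (G12.applyVec v).fold (fun (w : MVec) m c ↦ w.addTerms [(c, m)] 1) (G3.applyVec v)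
    lhs1.beq hv && hv.beq hv' && lhs2.beq rhs2 && lhs3.beq rhs3 && ev.beq e2

/-- **`sl₂` on `H*(A^[3])`** (960 monomials, all degrees including odd): the triple `(e_α, h, f_α)` of this
file satisfies the `sl₂` relations exactly, `h` is the degree operator `deg - 2n`, and the derivation
form of `e_α` equals the two-point `𝔊₀`-form. [cite: Oberdieck2021, §3.2 (e_α, h, and the Lefschetz dual via T_Γ)] -/
theorem sl2Check3 : sl2Check 3 = true := by native_decide

/-- `𝔊₀(e_I)`: the derivation form equals Li–Qin–Wang's two-point form on every basis monomial of
`H*(A^[n])`, for all `I` with `1 ≤ |I| ≤ 3`. [cite: LiQinWang2002W, Thm 3.1(ii) (with 𝔏₀ = 𝔊₀ for e = 0)] -/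
def G0Check (n : Nat) : Bool :=
  (List.range 16).all fun I ↦ deg4 I == 0 || deg4 I == 4 ||
    let A := mkG 0 I n "two-point"
    let D := mkG0 I "deriv"
    (fullBasis n).all fun mono ↦
      let v : MVec := (Std.HashMap.emptyWithCapacity 2).insert mono 1
      (A.applyVec v).beq (D.applyVec v)

/-- **`𝔊₀` two-point form = derivation form on `H*(A^[3])`** (14 classes × 960 monomials, exact). [cite: LiQinWang2002W, Thm 3.1(ii) (with 𝔏₀ = 𝔊₀ for e = 0)] -/
theorem G0_deriv_eq_twoPoint3 : G0Check 3 = true := by native_decide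

/-- The integral `∫_{A^[n]}` of an exact vector: the coefficient of `q₁(pt)ⁿ|0⟩`. [folklore] -/
def integral (n : Nat) (v : MVec) : ℚ := v.getD (List.replicate n 31) 0

/-- The classical numbers of `A^[2] = Bl_Δ(A×A)/𝔖₂` recomputed with the vertex operators:
`∫ D_α⁴ = 3(α,α)² = 12`, `∫ D_α² δ² = -8(α,α) = -16`, `∫ δ⁴ = 0`, where `D_α = 𝔊₀(α)·1`,
`δ = [∂A^[2]] = -2·𝔊₁(1)·1`, `1 = q₁(1)²|0⟩/2`. [cite: Lehn1999, Thm 3.10 and §4 (the boundary operator 𝔡 = -½[∂])] -/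
def ringA2Numbers : List ℚ :=
  let one : MVec := (Std.HashMap.emptyWithCapacity 2).insert [16, 16] ((1 : ℚ) / 2)
  let d := mkG 1 0 2 "G1(1)"
  let delta (v : MVec) : MVec := (d.applyVec v).fold (fun (w : MVec) m c ↦ w.addTerms [(c, m)] (-2)) (Std.HashMap.emptyWithCapacity 8)
  let e := eOp.applyVec
  [integral 2 (e (e (e (e one)))), integral 2 (e (e (delta (delta one)))), integral 2 (delta (delta (delta (delta one))))]

/-- **Ring check at `n = 2`:** `(∫ D_α⁴, ∫ D_α²δ², ∫ δ⁴) = (12, -16, 0)`. [cite: Lehn1999, Thm 3.10 and §4 (the boundary operator 𝔡 = -½[∂])] -/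
theorem ringA2Numbers_eq : ringA2Numbers = [12, -16, 0] := by native_decide

/-- **Betti numbers of the window** `H^{≤10}(A^[10])` from the monomial basis: Göttsche's stable values
`1, 4, 13, 40, 111, 284, 687, 1592, 3550, 7648, 16002`. [cite: Gottsche1993, Thm 2.3.10 (Betti numbers of Hilbert schemes of points of a surface)] -/
theorem betti_10_10 : gradedCount (basis 10 10) 10 = [1, 4, 13, 40, 111, 284, 687, 1592, 3550, 7648, 16002] := by
  native_decide

end Literature.Computation.AbelianHilbFock
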